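import Literature.AlgebraicGeometry.Resolution.ResolutionOfComponentsRegularLocus
import Literature.AlgebraicGeometry.Resolution.QuasiExcellentLocalization
import Mathlib.RingTheory.RingHom.FiniteType
import Mathlib.Topology.KrullDimension
import HarnessLib

/-!
# Closed subschemes of quasi-excellent schemes are quasi-excellent; Thm. 1.1 reduces to
# integral schemes

Topic: `Literature/AlgebraicGeometry/Resolution`. Supporting theorems for the named fact
`CossartPiltant2019General` (`QuasiExcellentSchemes.lean`; Cossart–Piltant 2019, Thm. 1.1 as
printed). `ResolutionOfComponentsRegularLocus.lean` proves Step 1 of the printed proof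
(proof of Prop. 4.6 [arXiv v1: 4.4]: "it can be assumed that `𝒳` is irreducible") in the form
"Thm. 1.1 follows from its case of integral CLOSED SUBSCHEMES of the schemes of Thm. 1.1". The
remaining (tacit) ingredient of that step is that such a closed subscheme again satisfies the
hypotheses of Thm. 1.1: it is reduced, separated, Noetherian, of dimension `≤ 3` — and
QUASI-EXCELLENT (EGA IV₂ 7.8.3 (ii): schemes locally of finite type over a quasi-excellent scheme
are quasi-excellent; Matsumura §32 p. 260: quasi-excellence "is closed under localisation,
finitely generated extensions and passing to quotients"). For closed immersions only quotients
and localisations are needed, and these are PROVED in this tree (`isGRing_of_surjective`,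
`isGRing_of_isLocalization`, `ExcellentRingsProofs.lean`; `isJ2Ring_of_isLocalization`,
`IsJ2Ring.of_finiteType`, `QuasiExcellentLocalization.lean`), so everything here is proved:

* `IsQuasiExcellentRing.of_surjective` — quotients of quasi-excellent rings are quasi-excellent;
* `isGRing_of_forall_exists_away`, `isJ2Ring_of_forall_exists_away`,
  `isQuasiExcellentRing_of_forall_exists_away` — a Noetherian ring `A` such that every prime has
  a basic open neighbourhood `D(f)` with `A_f` a G-ring (resp. J-2, quasi-excellent) is a G-ring
  (resp. J-2, quasi-excellent): the G-ring condition is prime-local (`A_𝔭 = (A_f)_{𝔭A_f}`), and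
  `Reg(B) ∩ D(f) = Reg(B_f)` for `B` of finite type over `A`;
* `Scheme.IsQuasiExcellent.of_isClosedImmersion` — **a closed subscheme of a locally Noetherian
  quasi-excellent scheme is quasi-excellent** (in the all-affine-opens sense of
  `Scheme.IsQuasiExcellent`: an affine open `V` of `Y ↪ X` is covered by basic opens
  `Y_f = Y_g`, `g ∈ Γ(Y, i⁻¹U)`, `U ⊆ X` affine, and `Γ(Y, i⁻¹U)` is a quotient of `Γ(X, U)`);
* `isNoetherian_of_isClosedImmersion`;
* `CossartPiltant2019General.of_integral` — **Cossart–Piltant Thm. 1.1 follows from its case of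
  integral schemes**: if every integral separated Noetherian quasi-excellent scheme of dimension
  `≤ 3` admits a resolution which is an isomorphism over exactly its regular locus, then
  `CossartPiltant2019General` holds; `cossartPiltant2019General_iff_integral` — and conversely.

No definitions and no named facts are introduced.

## Sources

* V. Cossart, O. Piltant, *Resolution of singularities of arithmetical threefolds*, J. Algebra
  529 (2019) 268–535 = arXiv:1412.0868, proof of Prop. 4.6 [v1: Prop. 4.4], Step 1.
  [CossartPiltant2019]
* H. Matsumura, *Commutative Ring Theory*, §32, p. 260. [Matsumura1987]
* A. Grothendieck, EGA IV₂ 7.8.3 (ii); The Stacks Project, Tag 07QU. [StacksProject]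
-/

noncomputable section

open CategoryTheory CategoryTheory.Limits AlgebraicGeometry TopologicalSpace Topology
  IsLocalRing

namespace Literature.AlgebraicGeometry.Resolution

universe u

/-! ## Quasi-excellent rings: quotients -/

/-- **A quotient of a quasi-excellent ring is quasi-excellent** (Matsumura §32 p. 260: the
class of quasi-excellent rings is closed under passing to quotients): G-ring by
`isGRing_of_surjective`, J-2 since a finite type algebra over the quotient is of finite type
over the ring. [cite: Matsumura1987, §32 p. 260] -/
theorem IsQuasiExcellentRing.of_surjective {A B : Type u} [CommRing A] [CommRing B] (f : A →+* B)
    (hf : Function.Surjective f) (hA : IsQuasiExcellentRing A) : IsQuasiExcellentRing B := by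
  refine ⟨isGRing_of_surjective f hf hA.isGRing, ?_⟩
  letI : Algebra A B := f.toAlgebra
  exact hA.isJ2Ring.of_finiteType (RingHom.FiniteType.of_surjective f hf)

/-- Quasi-excellence is invariant under ring isomorphisms. [folklore] -/
theorem IsQuasiExcellentRing.of_ringEquiv {A B : Type u} [CommRing A] [CommRing B] (e : A ≃+* B)
    (hA : IsQuasiExcellentRing A) : IsQuasiExcellentRing B :=
  IsQuasiExcellentRing.of_surjective e.toRingHom e.surjective hA

/-! ## Quasi-excellent rings: gluing from a basic open cover -/

/-- **The G-ring property is local on `Spec A`**: if every prime `𝔭` of the Noetherian ring `A`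
avoids some `f` with `A_f` a G-ring, then `A` is a G-ring — `A_𝔭 ≅ (A_f)_{𝔭 A_f}`, and a
localisation of a G-ring is a G-ring (`isGRing_of_isLocalization`); the regularity of the
completion map is transported along this isomorphism (`IsRegularHom.completion_of_surjective`).
[cite: Matsumura1987, §32 p. 256 (definition of G-ring) and p. 260] -/
theorem isGRing_of_forall_exists_away (A : Type u) [CommRing A] [IsNoetherianRing A]
    (h : ∀ (p : Ideal A) [p.IsPrime], ∃ (f : A) (Af : Type u) (_ : CommRing Af) (_ : Algebra A Af)
      (_ : IsLocalization.Away f Af), f ∉ p ∧ IsGRing Af) : IsGRing A := by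
  refine ⟨inferInstance, fun p _ => ?_⟩
  obtain ⟨f, Af, _, _, _, hfp, hAf⟩ := h p
  haveI : IsNoetherianRing Af := hAf.1
  have hdisj : Disjoint ((Submonoid.powers f : Submonoid A) : Set A) (p : Set A) := by
    rw [Set.disjoint_left]
    rintro _ ⟨n, rfl⟩ hn
    exact hfp (‹p.IsPrime›.mem_of_pow_mem n hn)
  set P : Ideal Af := Ideal.map (algebraMap A Af) p with hPdef
  haveI : P.IsPrime := IsLocalization.isPrime_of_isPrime_disjoint (.powers f) Af p ‹_› hdisj
  have hPp : P.comap (algebraMap A Af) = p :=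
    IsLocalization.under_map_of_isPrime_disjoint (.powers f) Af ‹_› hdisj
  -- `L := (A_f)_P` is a G-ring and a localisation of `A` at `p`
  have hL : IsGRing (Localization.AtPrime P) := isGRing_of_isLocalization P.primeCompl hAf
  haveI : IsScalarTower A Af (Localization.AtPrime P) := IsScalarTower.of_algebraMap_eq' rfl
  haveI : IsLocalization.AtPrime (Localization.AtPrime P) p := by
    have := IsLocalization.isLocalization_isLocalization_atPrime_isLocalization (.powers f)
      (Localization.AtPrime P) P
    convert this using 1
    ext x
    simp only [hPp]
  -- the G-ring condition of `L` at its maximal ideal, transported to `A_p`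
  have hreg := hL.2 (maximalIdeal (Localization.AtPrime P))
  let e₁ : Localization.AtPrime P ≃ₐ[Localization.AtPrime P]
      Localization.AtPrime (maximalIdeal (Localization.AtPrime P)) :=
    IsLocalization.atUnits (Localization.AtPrime P)
      (maximalIdeal (Localization.AtPrime P)).primeCompl fun x hx => by
        have hx' : x ∉ maximalIdeal (Localization.AtPrime P) := hx
        rwa [IsLocalRing.mem_maximalIdeal, mem_nonunits_iff, not_not] at hx'
  let e₂ : Localization.AtPrime P ≃ₐ[A] Localization.AtPrime p :=
    IsLocalization.algEquiv p.primeCompl _ _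
  let φ : Localization.AtPrime (maximalIdeal (Localization.AtPrime P)) →+*
      Localization.AtPrime p :=
    e₂.toRingEquiv.toRingHom.comp e₁.symm.toRingEquiv.toRingHom
  letI : Algebra (Localization.AtPrime (maximalIdeal (Localization.AtPrime P)))
      (Localization.AtPrime p) := φ.toAlgebra
  have hφ : Function.Surjective
      (algebraMap (Localization.AtPrime (maximalIdeal (Localization.AtPrime P)))
        (Localization.AtPrime p)) :=
    e₂.surjective.comp e₁.symm.surjective
  exact IsRegularHom.completion_of_surjective hφ hreg

/-- **The J-2 property is local on `Spec A`**: if every prime of the Noetherian ring `A` avoids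
some `f` with `A_f` J-2, then `A` is J-2 — for `B` of finite type over `A`, `B_f` is of finite
type over `A_f` and `Reg(B) ∩ D(f)` is the image of the open set `Reg(B_f)` under the open
embedding `Spec B_f → Spec B`. [cite: Matsumura1987, §32 p. 260] -/
theorem isJ2Ring_of_forall_exists_away (A : Type u) [CommRing A] [IsNoetherianRing A]
    (h : ∀ (p : Ideal A) [p.IsPrime], ∃ (f : A) (Af : Type u) (_ : CommRing Af) (_ : Algebra A Af)
      (_ : IsLocalization.Away f Af), f ∉ p ∧ IsJ2Ring Af) : IsJ2Ring A := by
  refine ⟨inferInstance, fun B _ _ hB => ?_⟩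
  rw [isOpen_iff_forall_mem_open]
  intro P hP
  obtain ⟨f, Af, _, _, _, hfp, hAf⟩ := h (P.asIdeal.comap (algebraMap A B))
  let Bf := Localization.Away (algebraMap A B f)
  have hft : (IsLocalization.Away.map Af Bf (algebraMap A B) f).FiniteType :=
    RingHom.localization_away_map_finiteType A B Af Bf (algebraMap A B) f
      (RingHom.finiteType_algebraMap.mpr hB)
  letI : Algebra Af Bf := (IsLocalization.Away.map Af Bf (algebraMap A B) f).toAlgebra
  have hBf : IsOpen (regularLocus Bf) := hAf.2 Bf hft
  refine ⟨PrimeSpectrum.comap (algebraMap B Bf) '' regularLocus Bf, ?_, ?_, ?_⟩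
  · rintro _ ⟨Q, hQ, rfl⟩
    exact (mem_regularLocus_iff_comap_of_isLocalization
      (Submonoid.powers (algebraMap A B f)) Q).mp hQ
  · exact (PrimeSpectrum.localization_away_isOpenEmbedding Bf (algebraMap A B f)).isOpenMap _
      hBf
  · have hPD : P ∈ Set.range (PrimeSpectrum.comap (algebraMap B Bf)) := by
      rw [PrimeSpectrum.localization_away_comap_range Bf (algebraMap A B f)]
      exact hfp
    obtain ⟨Q, rfl⟩ := hPD
    exact ⟨Q, (mem_regularLocus_iff_comap_of_isLocalization
      (Submonoid.powers (algebraMap A B f)) Q).mpr hP, rfl⟩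

/-- **Quasi-excellence is local on `Spec A`**: a Noetherian ring each of whose primes avoids
some `f` with `A_f` quasi-excellent is quasi-excellent. [cite: Matsumura1987, §32 p. 260] -/
theorem isQuasiExcellentRing_of_forall_exists_away (A : Type u) [CommRing A] [IsNoetherianRing A]
    (h : ∀ (p : Ideal A) [p.IsPrime], ∃ (f : A) (Af : Type u) (_ : CommRing Af) (_ : Algebra A Af)
      (_ : IsLocalization.Away f Af), f ∉ p ∧ IsQuasiExcellentRing Af) :
    IsQuasiExcellentRing A := by
  refine ⟨isGRing_of_forall_exists_away A fun p _ => ?_,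
    isJ2Ring_of_forall_exists_away A fun p _ => ?_⟩
  · obtain ⟨f, Af, _, _, _, h1, h2⟩ := h p
    exact ⟨f, Af, _, _, ‹_›, h1, h2.isGRing⟩
  · obtain ⟨f, Af, _, _, _, h1, h2⟩ := h p
    exact ⟨f, Af, _, _, ‹_›, h1, h2.isJ2Ring⟩

/-! ## Closed subschemes of quasi-excellent schemes -/

/-- **A closed subscheme of a locally Noetherian quasi-excellent scheme is quasi-excellent**
(EGA IV₂ 7.8.3 (ii); Matsumura §32 p. 260: quasi-excellence passes to quotients and
localisations). For an affine open `V` of `Y`, every point `v ∈ V` has a neighbourhood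
`Y_f = Y_g` which is basic open both in `V` and in the affine open `i⁻¹U`, `U ∋ i(v)` an affine
open of `X`; `Γ(Y, i⁻¹U)` is a quotient of the quasi-excellent ring `Γ(X, U)`, so
`Γ(Y, V)_f = Γ(Y, Y_g)` is quasi-excellent, and `isQuasiExcellentRing_of_forall_exists_away`
applies. [cite: Matsumura1987, §32 p. 260] -/
theorem Scheme.IsQuasiExcellent.of_isClosedImmersion {X Y : Scheme.{u}} (i : Y ⟶ X)
    [IsClosedImmersion i] [IsLocallyNoetherian X] (hX : Scheme.IsQuasiExcellent X) :
    Scheme.IsQuasiExcellent Y := by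
  haveI : IsLocallyNoetherian Y := LocallyOfFiniteType.isLocallyNoetherian i
  intro V
  haveI : IsNoetherianRing Γ(Y, V) := IsLocallyNoetherian.component_noetherian V
  refine isQuasiExcellentRing_of_forall_exists_away Γ(Y, V) fun 𝔭 _ => ?_
  -- the point of `V` corresponding to `𝔭`, an affine open of `X` around its image
  let v : Y := V.2.fromSpec ⟨𝔭, ‹_›⟩
  have hvV : v ∈ (V : Y.Opens) := by
    have := Set.mem_range_self (f := V.2.fromSpec) ⟨𝔭, ‹_›⟩
    rwa [V.2.range_fromSpec] at this
  obtain ⟨_, ⟨U, hU, rfl⟩, hvU, -⟩ :=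
    X.isBasis_affineOpens.exists_subset_of_mem_open (Set.mem_univ (i v)) isOpen_univ
  have hU' : IsAffineOpen (i ⁻¹ᵁ U) := hU.preimage i
  -- a common basic open neighbourhood of `v` in `V` and `i⁻¹U`
  obtain ⟨f, g, hfg, hvf⟩ := exists_basicOpen_le_affine_inter V.2 hU' v ⟨hvV, hvU⟩
  -- `Γ(Y, i⁻¹U)` is a quotient of `Γ(X, U)`, hence quasi-excellent; so is its localisation
  have hqU : IsQuasiExcellentRing Γ(Y, i ⁻¹ᵁ U) :=
    IsQuasiExcellentRing.of_surjective (i.app U).hom (i.app_surjective U hU) (hX ⟨U, hU⟩)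
  haveI := hU'.isLocalization_basicOpen g
  have hqg : IsQuasiExcellentRing Γ(Y, Y.basicOpen g) :=
    isQuasiExcellentRing_of_isLocalization (Submonoid.powers g) hqU
  have hqf : IsQuasiExcellentRing Γ(Y, Y.basicOpen f) := by
    rw [hfg]; exact hqg
  haveI := V.2.isLocalization_basicOpen f
  refine ⟨f, Γ(Y, Y.basicOpen f), inferInstance, inferInstance, inferInstance, ?_, hqf⟩
  -- `f ∉ 𝔭` since `v ∈ Y_f`
  have hv : (⟨𝔭, ‹_›⟩ : PrimeSpectrum Γ(Y, V)) ∈ V.2.fromSpec ⁻¹ᵁ Y.basicOpen f := hvf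
  rw [V.2.fromSpec_preimage_basicOpen] at hv
  exact hv

/-- A closed subscheme of a Noetherian scheme is Noetherian. [folklore] -/
theorem isNoetherian_of_isClosedImmersion {X Y : Scheme.{u}} (i : Y ⟶ X) [IsClosedImmersion i]
    [IsNoetherian X] : IsNoetherian Y := by
  haveI : IsLocallyNoetherian Y := LocallyOfFiniteType.isLocallyNoetherian i
  haveI : CompactSpace Y := QuasiCompact.compactSpace_of_compactSpace i
  exact {}

/-! ## Cossart–Piltant Thm. 1.1 reduces to integral schemes -/

/-- **Cossart–Piltant Thm. 1.1 follows from its case of integral schemes** (proof of Prop. 4.6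
[arXiv v1: 4.4], Step 1: "it can be assumed that `𝒳` is irreducible"): if every integral
separated Noetherian quasi-excellent scheme of dimension `≤ 3` admits a resolution (proper,
birational, regular source) which is an isomorphism over an open whose points are exactly its
regular locus, then `CossartPiltant2019General` holds — by
`CossartPiltant2019General.of_integral_closedSubschemes`, an integral closed subscheme of a
scheme as in Thm. 1.1 being again separated, Noetherian, quasi-excellent
(`Scheme.IsQuasiExcellent.of_isClosedImmersion`) and of dimension `≤ 3`.
[cite: CossartPiltant2019, proof of Prop. 4.6, Step 1] -/
theorem CossartPiltant2019General.of_integral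
    (H : ∀ (X : Scheme.{u}) [IsIntegral X] [X.IsSeparated] [IsNoetherian X],
      Scheme.IsQuasiExcellent X → topologicalKrullDim X ≤ 3 →
        ∃ (X' : Scheme.{u}) (π : X' ⟶ X), IsResolution π ∧
          ∃ U : X.Opens, (U : Set X) = Scheme.regularLocus X ∧ IsIso (π ∣_ U)) :
    CossartPiltant2019General.{u} := by
  refine CossartPiltant2019General.of_integral_closedSubschemes
    fun T _ _ _ hqe hdim Y i _ _ => ?_
  haveI : Y.IsSeparated := Scheme.isSeparated_of_isSeparated_over i
  haveI : IsNoetherian Y := isNoetherian_of_isClosedImmersion i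
  exact H Y (hqe.of_isClosedImmersion i)
    (i.isClosedEmbedding.isInducing.topologicalKrullDim_le.trans hdim)

/-- **Cossart–Piltant Thm. 1.1 is equivalent to its case of integral schemes**; the converse
direction is the specialisation of `CossartPiltant2019General` to integral (hence reduced)
schemes. [cite: CossartPiltant2019, proof of Prop. 4.6, Step 1] -/
theorem cossartPiltant2019General_iff_integral :
    CossartPiltant2019General.{u} ↔
      ∀ (X : Scheme.{u}) [IsIntegral X] [X.IsSeparated] [IsNoetherian X],
        Scheme.IsQuasiExcellent X → topologicalKrullDim X ≤ 3 →
          ∃ (X' : Scheme.{u}) (π : X' ⟶ X), IsResolution π ∧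
            ∃ U : X.Opens, (U : Set X) = Scheme.regularLocus X ∧ IsIso (π ∣_ U) :=
  ⟨fun h X _ _ _ hqe hdim => h X hqe hdim, CossartPiltant2019General.of_integral⟩

end Literature.AlgebraicGeometry.Resolution

end
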